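import Summits.CriticalPhenomena.Ising3DConformalLimit.Theses.PerfectScreening
import Summits.CriticalPhenomena.Ising3DConformalLimit.Theorems.MoebiusLimitExists.Negative.EtaExists
import Summits.CriticalPhenomena.Ising3DConformalLimit.Theorems.MoebiusLimitExists.Negative.RatioRegular

/-!
# Crux-triage r1/k1 checks for `GaussianLimitNotScreened` (stmt-CriticalPhenomena-13886)

Triager: refuter-cruxtri-stmt-CriticalPhenomena-13886-r1-1-0.

Purpose: the "first lemmas" of cards `free-regular-variation-dcp-window` (RegularVariationOnShells,
EtaOfLimit, delta_window), `karamata-amplitude-blind-merging` (AnnulusRegularVariation,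
ScalingDimensionLeThreeQuarters) and `amplitude-free-second-moment` (A0, A1/A3) are ALREADY tree
theorems (standing disprover of `MoebiusLimitExists`, `Theorems/MoebiusLimitExists/Negative/`
`EtaExists.lean` p69786, `RatioRegular.lean` p70403). This file derives them for the hypotheses of
13886 by one-line applications, and records the resulting ANATOMY of the crux:

* `delta_window`      : crux hyps ⇒ `Δ ∈ [1/2, 3/4]`;
* `etaOfLimit`        : crux hyps ⇒ `HasIsingExponentEta 3 (2Δ − 1)`;
* `shells`            : crux hyps ⇒ uniform two-point ratio asymptotics on comparable shells;
* `screened_of_gt_half` : crux hyps with `Δ > 1/2` ⇒ the two-point function IS perfectly screened,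
  so on `Δ ∈ (1/2, 3/4]` the crux is exactly "no such Gaussian limit exists" (`crux_iff_on_gt_half`);
* `crux_of_gt_three_quarters` : the crux restricted to `Δ > 3/4` holds (vacuously).

Hence 13886 = [no Gaussian Möbius non-degenerate limit with Δ ∈ (1/2, 3/4]] ∧ [at Δ = 1/2 such a
limit forbids ‖x‖G → 0]; inversion covariance is never used below.
-/

noncomputable section

namespace Summit.CriticalPhenomena.Ising3DConformalLimit.Cruxes.GaussianLimitNotScreened.TriageR1K1

open Literature.Probability.LatticeModels Filter Set
open Summit.CriticalPhenomena.Ising3DConformalLimit.MoebiusLimitExistsNegative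
open scoped Topology

/-- The hypotheses of the crux (without `U₄ ≡ 0` and without the screening clause). -/
def CruxHyps (ρ : ℝ → ℝ) (Δ : ℝ) (S : CorrFamily 3) : Prop :=
  (∀ δ ∈ Set.Ioc (0:ℝ) 1, 0 < ρ δ) ∧ HasPointwiseScalingLimit (criticalCorr 3) ρ S ∧
    IsNondegenerateTwoPoint S ∧ IsMoebiusCovariant Δ S

variable {ρ : ℝ → ℝ} {Δ : ℝ} {S : CorrFamily 3}

/-- Card 1 `EtaOfLimit` (= card 3 FL2's input, card 5 A1): already a tree theorem. -/
theorem etaOfLimit (h : CruxHyps ρ Δ S) : HasIsingExponentEta 3 (2 * Δ - 1) :=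
  hasIsingExponentEta_of_covariantLimit h.1 h.2.1 h.2.2.1 h.2.2.2.isEuclideanInvariant.2
    h.2.2.2.isScaleCovariant

/-- Card 1 `delta_window` = card 3 `ScalingDimensionLeThreeQuarters` = card 5 A0: tree theorem. -/
theorem delta_window (h : CruxHyps ρ Δ S) : Δ ∈ Set.Icc (1 / 2 : ℝ) (3 / 4) :=
  delta_mem_Icc_of_covariantLimit h.1 h.2.1 h.2.2.1 h.2.2.2.isEuclideanInvariant.2
    h.2.2.2.isScaleCovariant

/-- Card 1 `RegularVariationOnShells` = card 3 `AnnulusRegularVariation` = card 5 A3: tree theorem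
(`two_point_ratio_asymptotics`, RatioRegular.lean). -/
theorem shells (h : CruxHyps ρ Δ S) {ε : ℝ} (hε : 0 < ε) :
    ∃ R : ℝ, ∀ x y : Site 3, R ≤ ‖x‖ → ‖siteVec x‖ / 2 ≤ ‖siteVec y‖ →
      ‖siteVec y‖ ≤ 2 * ‖siteVec x‖ →
        |criticalTwoPoint 3 y / criticalTwoPoint 3 x -
          (‖siteVec y‖ / ‖siteVec x‖) ^ (-(2:ℝ) * Δ)| ≤ ε :=
  two_point_ratio_asymptotics h.1 h.2.1 h.2.2.1 h.2.2.2.isEuclideanInvariant.2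
    h.2.2.2.isScaleCovariant hε

/-- ANATOMY 1: under the crux hypotheses with `Δ > 1/2` the critical two-point function IS
perfectly screened (`‖x‖·G(x) → 0`), by the logarithmic exponent `η = 2Δ − 1 > 0`. So on
`Δ ∈ (1/2, 3/4]` the screening clause of 13886 is automatic and the crux asserts NON-EXISTENCE. -/
theorem screened_of_gt_half (h : CruxHyps ρ Δ S) (hΔ : 1 / 2 < Δ) :
    Tendsto (fun x : Site 3 => ‖x‖ * criticalTwoPoint 3 x) cofinite (𝓝 0) := by
  have hη : HasSpatialDecayExponent (criticalTwoPoint 3) (((3:ℕ) : ℝ) - 2 + (2 * Δ - 1)) :=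
    etaOfLimit h
  have hε : 0 < (2 * Δ - 1) / 2 := by linarith
  obtain ⟨K, hK, hbound⟩ := hη.exists_le_mul_rpow hε
  -- the comparison function `K ‖x‖^{1/2 - Δ} → 0`
  have hexp : (1 / 2 : ℝ) - Δ < 0 := by linarith
  have hcmp : Tendsto (fun x : Site 3 => K * ‖x‖ ^ ((1 / 2 : ℝ) - Δ)) cofinite (𝓝 0) := by
    have h1 : Tendsto (fun x : Site 3 => ‖x‖ ^ ((1 / 2 : ℝ) - Δ)) cofinite (𝓝 0) := by
      have hc := (tendsto_rpow_neg_atTop (show 0 < Δ - 1 / 2 by linarith)).comp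
        (Site.tendsto_norm_cofinite_atTop (d := 3))
      refine hc.congr fun x => ?_
      show ‖x‖ ^ (-(Δ - 1 / 2)) = ‖x‖ ^ ((1 / 2 : ℝ) - Δ)
      congr 1
      ring
    simpa using h1.const_mul K
  refine squeeze_zero' ?_ ?_ hcmp
  · exact Eventually.of_forall fun x => mul_nonneg (norm_nonneg _) (criticalTwoPoint_nonneg' x)
  · have hne : ∀ᶠ x : Site 3 in cofinite, x ≠ 0 := by
      have : {x : Site 3 | x ≠ 0}ᶜ.Finite := by simp
      exact this
    filter_upwards [hne] with x hx
    have hxpos : 0 < ‖x‖ := norm_pos_iff.2 hx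
    have hb := hbound x hx
    have hpow : ‖x‖ * ‖x‖ ^ (-(((3:ℕ) : ℝ) - 2 + (2 * Δ - 1)) + (2 * Δ - 1) / 2) =
        ‖x‖ ^ ((1 / 2 : ℝ) - Δ) := by
      have e : (-(((3:ℕ) : ℝ) - 2 + (2 * Δ - 1)) + (2 * Δ - 1) / 2) = ((1 / 2 : ℝ) - Δ) - 1 := by
        push_cast; ring
      rw [e, Real.rpow_sub_one hxpos.ne', mul_div_cancel₀ _ hxpos.ne']
    calc ‖x‖ * criticalTwoPoint 3 x
        ≤ ‖x‖ * (K * ‖x‖ ^ (-(((3:ℕ) : ℝ) - 2 + (2 * Δ - 1)) + (2 * Δ - 1) / 2)) :=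
          mul_le_mul_of_nonneg_left hb hxpos.le
      _ = K * (‖x‖ * ‖x‖ ^ (-(((3:ℕ) : ℝ) - 2 + (2 * Δ - 1)) + (2 * Δ - 1) / 2)) := by ring
      _ = K * ‖x‖ ^ ((1 / 2 : ℝ) - Δ) := by rw [hpow]

/-- ANATOMY 2: on `Δ > 1/2` the crux is EQUIVALENT to non-existence of a Gaussian limit with those
hypotheses (the screening clause is idle there). -/
theorem crux_iff_on_gt_half :
    (∀ (ρ : ℝ → ℝ) (Δ : ℝ) (S : CorrFamily 3), 1 / 2 < Δ → (∀ δ ∈ Set.Ioc (0:ℝ) 1, 0 < ρ δ) →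
      HasPointwiseScalingLimit (criticalCorr 3) ρ S → IsNondegenerateTwoPoint S →
      IsMoebiusCovariant Δ S → ¬ HasNontrivialU4 S →
      ¬ Tendsto (fun x : Site 3 => ‖x‖ * criticalTwoPoint 3 x) cofinite (𝓝 0)) ↔
    (∀ (ρ : ℝ → ℝ) (Δ : ℝ) (S : CorrFamily 3), 1 / 2 < Δ → (∀ δ ∈ Set.Ioc (0:ℝ) 1, 0 < ρ δ) →
      HasPointwiseScalingLimit (criticalCorr 3) ρ S → IsNondegenerateTwoPoint S →
      IsMoebiusCovariant Δ S → HasNontrivialU4 S) := by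
  constructor
  · intro h ρ Δ S hΔ hρ hlim hnd hM
    by_contra hU4
    exact h ρ Δ S hΔ hρ hlim hnd hM hU4 (screened_of_gt_half ⟨hρ, hlim, hnd, hM⟩ hΔ)
  · intro h ρ Δ S hΔ hρ hlim hnd hM hU4 _
    exact hU4 (h ρ Δ S hΔ hρ hlim hnd hM)

/-- ANATOMY 3: the crux restricted to `Δ > 3/4` holds vacuously (DCP25 Thm 1.5 in the limit). -/
theorem crux_of_gt_three_quarters (ρ : ℝ → ℝ) (Δ : ℝ) (S : CorrFamily 3) (hΔ : 3 / 4 < Δ)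
    (hρ : ∀ δ ∈ Set.Ioc (0:ℝ) 1, 0 < ρ δ) (hlim : HasPointwiseScalingLimit (criticalCorr 3) ρ S)
    (hnd : IsNondegenerateTwoPoint S) (hM : IsMoebiusCovariant Δ S) :
    ¬ Tendsto (fun x : Site 3 => ‖x‖ * criticalTwoPoint 3 x) cofinite (𝓝 0) := by
  have := (delta_window ⟨hρ, hlim, hnd, hM⟩).2
  exact absurd this (not_le.2 hΔ)

/-- ANATOMY 4 (the whole crux from its `Δ = 1/2` corner plus non-existence on `(1/2, 3/4]`):
`GaussianLimitNotScreened` follows from (a) no Gaussian limit with `Δ ∈ (1/2, 3/4]` and (b) the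
amplitude statement at `Δ = 1/2`. Pure logic over `delta_window`. -/
theorem crux_of_corners
    (hmid : ∀ (ρ : ℝ → ℝ) (Δ : ℝ) (S : CorrFamily 3), 1 / 2 < Δ → Δ ≤ 3 / 4 →
      (∀ δ ∈ Set.Ioc (0:ℝ) 1, 0 < ρ δ) → HasPointwiseScalingLimit (criticalCorr 3) ρ S →
      IsNondegenerateTwoPoint S → IsMoebiusCovariant Δ S → HasNontrivialU4 S)
    (hhalf : ∀ (ρ : ℝ → ℝ) (S : CorrFamily 3),
      (∀ δ ∈ Set.Ioc (0:ℝ) 1, 0 < ρ δ) → HasPointwiseScalingLimit (criticalCorr 3) ρ S →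
      IsNondegenerateTwoPoint S → IsMoebiusCovariant (1 / 2) S → ¬ HasNontrivialU4 S →
      ¬ Tendsto (fun x : Site 3 => ‖x‖ * criticalTwoPoint 3 x) cofinite (𝓝 0)) :
    Summit.CriticalPhenomena.Ising3DConformalLimit.Theses.PerfectScreening.GaussianLimitNotScreened := by
  intro ρ Δ S hρ hlim hnd hM hU4
  have hw := delta_window ⟨hρ, hlim, hnd, hM⟩
  rcases eq_or_lt_of_le hw.1 with heq | hgt
  · subst heq
    exact hhalf ρ S hρ hlim hnd hM hU4
  · exact absurd (hmid ρ Δ S hgt hw.2 hρ hlim hnd hM) hU4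

/-! ### Card `unit-thermal-drift-inverse-z`: the bookkeeping behind B0 and the cancellation (a)

Pure algebra, kernel-checked: with the thermal responses `∂χ = 6χ² + U₀`, `∂M₂ = 12χM₂ + 6χ² + U₂`
(Wick parts `M₀ = 6χ²`, `M₂(W) = 12χM₂ + 6χ²`, verified by hand in NOTES.md), the quotient rule gives
`d/dβ [M₂/(6χ²)] = 1 + U₂/(6χ²) − U₀M₂/(3χ³)`, and a momentum-independent vertex `U = −κ W` gives `Θ = −κ`. -/

/-- B0's "1": the quotient-rule value of `d/dβ [M₂/(6χ²)]` under the two response identities. -/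
example (χ M₂ U₀ U₂ : ℝ) (hχ : χ ≠ 0) :
    ((12 * χ * M₂ + 6 * χ ^ 2 + U₂) * (6 * χ ^ 2) - M₂ * (6 * (2 * χ * (6 * χ ^ 2 + U₀)))) /
        (6 * χ ^ 2) ^ 2 =
      1 + U₂ / (6 * χ ^ 2) - U₀ * M₂ / (3 * χ ^ 3) := by
  field_simp
  ring

/-- Cancellation (a): `U₀ = −κ·6χ²`, `U₂ = −κ(12χM₂ + 6χ²)` ⇒ `Θ := |U₀|M₂/(3χ³) − |U₂|/(6χ²) = −κ`
(for `κ ≥ 0`, `χ > 0`, `M₂ ≥ 0`, so that the absolute values open as written). -/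
example (χ M₂ κ : ℝ) (hχ : 0 < χ) (hM : 0 ≤ M₂) (hκ : 0 ≤ κ) :
    |(-κ) * (6 * χ ^ 2)| * M₂ / (3 * χ ^ 3) - |(-κ) * (12 * χ * M₂ + 6 * χ ^ 2)| / (6 * χ ^ 2) = -κ := by
  have h1 : |(-κ) * (6 * χ ^ 2)| = κ * (6 * χ ^ 2) := by
    rw [abs_mul, abs_neg, abs_of_nonneg hκ, abs_of_nonneg (by positivity)]
  have h2 : |(-κ) * (12 * χ * M₂ + 6 * χ ^ 2)| = κ * (12 * χ * M₂ + 6 * χ ^ 2) := by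
    rw [abs_mul, abs_neg, abs_of_nonneg hκ, abs_of_nonneg (by positivity)]
  rw [h1, h2]
  field_simp
  ring

/-- d = 1 sanity check of B0 quoted by the card: with `t = tanh β`, `M₂/(2χ²) = t/(1 − t²)` and
`d/dt [t/(1−t²)] · (1 − t²) = 1 + 2t²/(1 − t²)` (chain rule with `dt/dβ = 1 − t²`). -/
example (t : ℝ) (ht : t ^ 2 ≠ 1) :
    ((1 * (1 - t ^ 2) - t * (-(2 * t))) / (1 - t ^ 2) ^ 2) * (1 - t ^ 2) = 1 + 2 * t ^ 2 / (1 - t ^ 2) := by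
  have h : (1 - t ^ 2) ≠ 0 := by intro h0; apply ht; linarith
  field_simp
  ring

end Summit.CriticalPhenomena.Ising3DConformalLimit.Cruxes.GaussianLimitNotScreened.TriageR1K1

end
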